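import Summits.AtomisticToContinuum.Crystallization.Theorems.FrustratedLawDichotomyTransportPriceTruncated

/-!
# FrustratedLawDichotomy · crux `AperiodicFrustratedLawGap` (stmt-AtomisticToContinuum-27623) — LOCALISATION III: THE FINITE-CLUSTER PRICE
# (decomp-a2c, prover hand 2, structural share, generation 3)

The end of the transport line: a residual that quantifies over FINITE POINT SETS only.  `truncatedSurplusPrice_of_finiteClusterPrice`:
if for every hard core `δ > 0` and texture radii `R₇ R₈ R₉` there are a sharing radius `r > 0` and a cutoff `Rc ≥ 7/10` such that EVERY FINITE
cluster `ω ⊆ B̄(0, 2r + Rc + 1)` containing the origin, `δ`- and `7/10`-separated, and TEXTURE-CHARGED around each of its points `q` with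
`‖q‖ ≤ r` at radius `r + Rc` (two-way `ε`-matching, for every `ε ∈ (0,1]`, with a finite `7/10`-separated all-1/20-bad textured `TexBall`
configuration — the crux's clause (d) read on the cluster), satisfies the FINITE INEQUALITY

  `0 < Σ_{y ∈ ω, ‖y‖ ≤ r} ( ½ Σ_{q ∈ ω, ‖q − y‖ ≤ Rc} V_LJ(‖q − y‖) − T(Rc) − e⋆ ) / #{q ∈ ω : ‖q − y‖ ≤ r}`,
  `T(Rc) = ½((10/7)⁶/12 + 1/6)·250·(10/7)³·Rc⁻³`,

then the truncated surplus price of `…TransportPriceTruncated` holds (the cluster is the configuration's content of the ball `B̄(0, 2r+Rc+1)`;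
set integrals over re-rooted counting measures are the finite sums), hence the crux BY NAME, the registered stub `S_aperiodicErgodicGap`
(verbatim) and the `PeriodicChargeSplit` copy (`aperiodicFrustratedLawGap_of_finiteClusterPrice`, …).  This is the INSTRUMENTABLE form of the
residual: one semi-algebraic inequality per finite cluster of bounded radius (Hales–Flyspeck shape).  All `[folklore]`.
-/

noncomputable section

namespace Summit.AtomisticToContinuum.Crystallization.Theorems.FrustratedLawDichotomyTransportPriceFinite

open MeasureTheory Metric Set Filter
open scoped ENNReal Topology BigOperators
open Literature.MathematicalPhysics.StatisticalMechanics Literature.Probability.Process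
open Summit.AtomisticToContinuum.Crystallization.Theorems.ChargedEnergyGapNegative (E3 eStar)
open Summit.AtomisticToContinuum.Crystallization.Theorems.FrustratedLawDichotomyTransportPriceTruncated
  (aperiodicFrustratedLawGap_of_truncatedSurplusPrice aperiodicErgodicGap_of_truncatedSurplusPrice
    periodicChargeSplit_aperiodicFrustratedLawGap_of_truncatedSurplusPrice)
open Literature.Probability.Process.LocalConfig (finite_inter_of_separated)

section Sums

variable {S : Set E3}

/-- Re-rooting a ball: `(· − y)⁻¹' B̄_R(0) = B̄_R(y)`. [folklore] -/
theorem preimage_sub_closedBall (y : E3) (R : ℝ) :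
    (fun x : E3 => x - y) ⁻¹' closedBall (0 : E3) R = closedBall y R := by
  ext x
  simp [mem_closedBall, dist_eq_norm]

/-- The re-rooted configuration's ball count is the original ball count: `(θ_y μ)(B̄_R(0)) = μ(B̄_R(y))`. [folklore] -/
theorem map_sub_apply_closedBall (μ : Measure E3) (y : E3) (R : ℝ) :
    (μ.map fun x : E3 => x - y) (closedBall (0 : E3) R) = μ (closedBall y R) := by
  rw [Measure.map_apply (measurable_sub_const y) measurableSet_closedBall, preimage_sub_closedBall]

/-- Ball counts of a separated counting configuration are finite-set cardinalities. [folklore] -/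
theorem count_restrict_closedBall_eq_card (y : E3) (R : ℝ) (hfin : (closedBall y R ∩ S).Finite) :
    (Measure.count : Measure E3).restrict S (closedBall y R) = (hfin.toFinset.card : ℝ≥0∞) := by
  rw [Measure.restrict_apply measurableSet_closedBall, Measure.count_apply_finite _ hfin]

/-- The truncated re-rooted energy of a separated counting configuration is a finite sum. [folklore] -/
theorem setIntegral_map_sub_eq_sum (y : E3) (Rc : ℝ) (hfin : (closedBall y Rc ∩ S).Finite) :
    ∫ z in closedBall (0 : E3) Rc, lennardJones ‖z‖ ∂(((Measure.count : Measure E3).restrict S).map fun x : E3 => x - y) =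
      ∑ q ∈ hfin.toFinset, lennardJones ‖q - y‖ := by
  have hLJm : Measurable fun z : E3 => lennardJones ‖z‖ := by
    have : Measurable lennardJones := by unfold lennardJones; fun_prop
    exact this.comp measurable_norm
  rw [setIntegral_map measurableSet_closedBall hLJm.aestronglyMeasurable (measurable_sub_const y).aemeasurable,
    preimage_sub_closedBall, Measure.restrict_restrict measurableSet_closedBall]
  have hcoe : (Measure.count : Measure E3).restrict (closedBall y Rc ∩ S) =
      (Measure.count : Measure E3).restrict (↑hfin.toFinset : Set E3) := by rw [Finite.coe_toFinset]
  rw [hcoe, integral_count_restrict_coe_finset]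

end Sums

/-- **FINITE-CLUSTER PRICE ⟹ TRUNCATED SURPLUS PRICE.** [folklore] -/
theorem truncatedSurplusPrice_of_finiteClusterPrice
    (h : ∀ δ : ℝ, 0 < δ → ∀ R₇ R₈ R₉ : ℝ, let Gy : ℝ → (N : ℕ) → (Fin N → EuclideanSpace ℝ (Fin 3)) → Fin N → Prop := fun η N y j => let d : ℝ := sInf ((fun z => dist z (y (j : Fin N))) '' (Set.range (y) \ {(y (j : Fin N))})); let T : Set (EuclideanSpace ℝ (Fin 3)) := {z : EuclideanSpace ℝ (Fin 3) | z ∈ Set.range (y) ∧ z ≠ (y (j : Fin N)) ∧ dist z (y (j : Fin N)) < 13 / 10 * d}; ∃ A : EuclideanSpace ℝ (Fin 3) →ₗᵢ[ℝ] EuclideanSpace ℝ (Fin 3), (∃ e : ↥T ≃ ↥Literature.Geometry.DiscreteGeometry.fccKissingPattern, ∀ t : ↥T, dist (d⁻¹ • ((t : EuclideanSpace ℝ (Fin 3)) - (y (j : Fin N)))) (A ((e t : ↥Literature.Geometry.DiscreteGeometry.fccKissingPattern) : EuclideanSpace ℝ (Fin 3))) ≤ η) ∨ (∃ e : ↥T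 ≃ ↥Literature.Geometry.DiscreteGeometry.hcpKissingPattern, ∀ t : ↥T, dist (d⁻¹ • ((t : EuclideanSpace ℝ (Fin 3)) - (y (j : Fin N)))) (A ((e t : ↥Literature.Geometry.DiscreteGeometry.hcpKissingPattern) : EuclideanSpace ℝ (Fin 3))) ≤ η); let TexBall : (N : ℕ) → (Fin N → EuclideanSpace ℝ (Fin 3)) → Fin N → ℝ → ℝ → ℝ → ℝ → Prop := fun N y i R R₇ R₈ R₉ => (∀ a b : Fin N, a ≠ b → (7 : ℝ) / 10 ≤ dist (y a) (y b)) ∧ (∀ j : Fin N, dist (y j) (y i) ≤ R → ¬ Gy (1 / 20) N (y) j) ∧ (∀ j : Fin N, dist (y j) (y i) ≤ R → ¬ ((∀ j' : Fin N, dist (y j') (y j) ≤ R₇ → ¬ Gy (1 / 20) N (y) j') ∧ (∀ z : EuclideanSpace ℝ (Fin 3), dist z (y j) ≤ R₇ → ∃ k : Fin N, dist z (y k) ≤ 1) ∧ (∀ j' : Fin N, dist (y j') (y j) ≤ R₇ → (let d : ℝ := sInf ((fun z => dist z (y j')) '' (Set.range (y) \ {(y j')})); ∀ k : Fin N, y k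 ≠ y j' → dist (y k) (y j') < 27 / 20 * d → 5 ≤ Nat.card {m : Fin N // y m ≠ y j' ∧ dist (y m) (y j') < 27 / 20 * d ∧ y m ≠ y k ∧ dist (y m) (y k) < 27 / 20 * d})))) ∧ (∀ j : Fin N, dist (y j) (y i) ≤ R → ∃ k : Fin N, dist (y k) (y j) ≤ R₈ ∧ Gy (1 / 8) N (y) k) ∧ (∀ j : Fin N, dist (y j) (y i) ≤ R → ¬ ((∀ j' : Fin N, dist (y j') (y j) ≤ R₉ → ¬ Gy (1 / 20) N (y) j') ∧ (Nat.card {j' : Fin N // dist (y j') (y j) ≤ R₉ ∧ ¬ Gy (1 / 8) N (y) j'} : ℝ) ≤ 1 / 2 * (Nat.card {j' : Fin N // dist (y j') (y j) ≤ R₉} : ℝ) ∧ (∀ j' : Fin N, dist (y j') (y j) ≤ R₉ → ¬ Gy (1 / 8) N (y) j' → ¬ (let d : ℝ := sInf ((fun z => dist z (y j')) '' (Set.range (y) \ {(y j')})); ∀ k : Fin N, y k ≠ y j' → dist (y k) (y j') < 27 / 20 * d → 5 ≤ Nat.card {m : Fin N // y m ≠ y j' ∧ dist (y m) (y j') < 27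 / 20 * d ∧ y m ≠ y k ∧ dist (y m) (y k) < 27 / 20 * d})))); ∃ r : ℝ, 0 < r ∧ ∃ Rc : ℝ, 7 / 10 ≤ Rc ∧ ∀ ω : Finset (EuclideanSpace ℝ (Fin 3)), (0 : EuclideanSpace ℝ (Fin 3)) ∈ ω → (∀ p ∈ ω, ‖p‖ ≤ 2 * r + Rc + 1) → (∀ a ∈ ω, ∀ b ∈ ω, a ≠ b → δ ≤ dist a b) → (∀ a ∈ ω, ∀ b ∈ ω, a ≠ b → (7 : ℝ) / 10 ≤ dist a b) → (∀ q ∈ ω, ‖q‖ ≤ r → ∀ ε : ℝ, 0 < ε → ε ≤ 1 → ∃ (N : ℕ) (y : Fin N → EuclideanSpace ℝ (Fin 3)) (i : Fin N), TexBall N y i (r + Rc) R₇ R₈ R₉ ∧ (∀ p ∈ ω, dist p q ≤ r + Rc → ∃ k : Fin N, dist (y k - y i) (p - q) ≤ ε) ∧ (∀ k : Fin N, dist (y k) (y i) ≤ r + Rc → ∃ p ∈ ω, dist (y k - y i) (p - q) ≤ ε)) → 0 < (∑ y ∈ ω.filter (fun y : EuclideanSpace ℝ (Fin 3) => ‖y‖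 ≤ r), ((∑ q ∈ ω.filter (fun q : EuclideanSpace ℝ (Fin 3) => ‖q - y‖ ≤ Rc), Literature.MathematicalPhysics.StatisticalMechanics.lennardJones ‖q - y‖) / 2 - ((7 / 10 : ℝ)⁻¹ ^ 6 / 12 + 1 / 6) * (250 * (7 / 10 : ℝ)⁻¹ ^ 3 * Rc⁻¹ ^ 3) / 2 - (⨅ Q : Literature.MathematicalPhysics.StatisticalMechanics.PeriodicConfiguration 3, Q.energyPerParticle Literature.MathematicalPhysics.StatisticalMechanics.lennardJones)) / ((ω.filter (fun q : EuclideanSpace ℝ (Fin 3) => ‖q - y‖ ≤ r)).card : ℝ))) :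
    ∀ δ : ℝ, 0 < δ → ∀ R₇ R₈ R₉ : ℝ, let Gy : ℝ → (N : ℕ) → (Fin N → EuclideanSpace ℝ (Fin 3)) → Fin N → Prop := fun η N y j => let d : ℝ := sInf ((fun z => dist z (y (j : Fin N))) '' (Set.range (y) \ {(y (j : Fin N))})); let T : Set (EuclideanSpace ℝ (Fin 3)) := {z : EuclideanSpace ℝ (Fin 3) | z ∈ Set.range (y) ∧ z ≠ (y (j : Fin N)) ∧ dist z (y (j : Fin N)) < 13 / 10 * d}; ∃ A : EuclideanSpace ℝ (Fin 3) →ₗᵢ[ℝ] EuclideanSpace ℝ (Fin 3), (∃ e : ↥T ≃ ↥Literature.Geometry.DiscreteGeometry.fccKissingPattern, ∀ t : ↥T, dist (d⁻¹ • ((t : EuclideanSpace ℝ (Fin 3)) - (y (j : Fin N)))) (A ((e t : ↥Literature.Geometry.DiscreteGeometry.fccKissingPattern) : EuclideanSpace ℝ (Fin 3))) ≤ η) ∨ (∃ e : ↥T ≃ ↥Literature.Geometry.DiscreteGeometry.hcpKissingPattern, ∀ t : ↥T, dist (d⁻¹ • ((t : EuclideanSpace ℝ (Fin 3)) - (y (j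 : Fin N)))) (A ((e t : ↥Literature.Geometry.DiscreteGeometry.hcpKissingPattern) : EuclideanSpace ℝ (Fin 3))) ≤ η); let TexBall : (N : ℕ) → (Fin N → EuclideanSpace ℝ (Fin 3)) → Fin N → ℝ → ℝ → ℝ → ℝ → Prop := fun N y i R R₇ R₈ R₉ => (∀ a b : Fin N, a ≠ b → (7 : ℝ) / 10 ≤ dist (y a) (y b)) ∧ (∀ j : Fin N, dist (y j) (y i) ≤ R → ¬ Gy (1 / 20) N (y) j) ∧ (∀ j : Fin N, dist (y j) (y i) ≤ R → ¬ ((∀ j' : Fin N, dist (y j') (y j) ≤ R₇ → ¬ Gy (1 / 20) N (y) j') ∧ (∀ z : EuclideanSpace ℝ (Fin 3), dist z (y j) ≤ R₇ → ∃ k : Fin N, dist z (y k) ≤ 1) ∧ (∀ j' : Fin N, dist (y j') (y j) ≤ R₇ → (let d : ℝ := sInf ((fun z => dist z (y j')) '' (Set.range (y) \ {(y j')})); ∀ k : Fin N, y k ≠ y j' → dist (y k) (y j') < 27 / 20 * d → 5 ≤ Nat.card {m : Fin N // y m ≠ y j' ∧ dist (y m) (y j') < 27 / 20 * d ∧ y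 m ≠ y k ∧ dist (y m) (y k) < 27 / 20 * d})))) ∧ (∀ j : Fin N, dist (y j) (y i) ≤ R → ∃ k : Fin N, dist (y k) (y j) ≤ R₈ ∧ Gy (1 / 8) N (y) k) ∧ (∀ j : Fin N, dist (y j) (y i) ≤ R → ¬ ((∀ j' : Fin N, dist (y j') (y j) ≤ R₉ → ¬ Gy (1 / 20) N (y) j') ∧ (Nat.card {j' : Fin N // dist (y j') (y j) ≤ R₉ ∧ ¬ Gy (1 / 8) N (y) j'} : ℝ) ≤ 1 / 2 * (Nat.card {j' : Fin N // dist (y j') (y j) ≤ R₉} : ℝ) ∧ (∀ j' : Fin N, dist (y j') (y j) ≤ R₉ → ¬ Gy (1 / 8) N (y) j' → ¬ (let d : ℝ := sInf ((fun z => dist z (y j')) '' (Set.range (y) \ {(y j')})); ∀ k : Fin N, y k ≠ y j' → dist (y k) (y j') < 27 / 20 * d → 5 ≤ Nat.card {m : Fin N // y m ≠ y j' ∧ dist (y m) (y j') < 27 / 20 * d ∧ y m ≠ y k ∧ dist (y m) (y k) < 27 / 20 * d})))); let Appr : MeasureTheory.Measure (EuclideanSpace ℝ (Fin 3)) → ℝ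 → ℝ → ℝ → Prop := fun μ R₇ R₈ R₉ => ∀ q : EuclideanSpace ℝ (Fin 3), μ {q} ≠ 0 → ∀ R ε : ℝ, 0 < ε → ∃ (N : ℕ) (y : Fin N → EuclideanSpace ℝ (Fin 3)) (i : Fin N), TexBall N y i R R₇ R₈ R₉ ∧ (∀ p : EuclideanSpace ℝ (Fin 3), μ {p} ≠ 0 → dist p q ≤ R → ∃ k : Fin N, dist (y k - y i) (p - q) ≤ ε) ∧ (∀ k : Fin N, dist (y k) (y i) ≤ R → ∃ p : EuclideanSpace ℝ (Fin 3), μ {p} ≠ 0 ∧ dist (y k - y i) (p - q) ≤ ε); ∃ r : ℝ, 0 < r ∧ ∃ Rc : ℝ, 7 / 10 ≤ Rc ∧ (∀ μ : MeasureTheory.Measure (EuclideanSpace ℝ (Fin 3)), Literature.Probability.Process.IsRootedHardCore δ μ → Literature.Probability.Process.IsRootedHardCore (7 / 10) μ → Appr μ R₇ R₈ R₉ → (∀ p : EuclideanSpace ℝ (Fin 3), μ {p} ≠ 0 → ∀ y : EuclideanSpace ℝ (Fin 3), (∀ q : EuclideanSpace ℝ (Fin 3), μ {q} ≠ 0 →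 q ≠ p → y ≠ q) → ∑' q : {q : EuclideanSpace ℝ (Fin 3) // μ {q} ≠ 0 ∧ q ≠ p}, Literature.MathematicalPhysics.StatisticalMechanics.lennardJones (dist p (q : EuclideanSpace ℝ (Fin 3))) ≤ ∑' q : {q : EuclideanSpace ℝ (Fin 3) // μ {q} ≠ 0 ∧ q ≠ p}, Literature.MathematicalPhysics.StatisticalMechanics.lennardJones (dist y (q : EuclideanSpace ℝ (Fin 3)))) → (∀ p : EuclideanSpace ℝ (Fin 3), μ {p} ≠ 0 → HasSum (fun q : {q : EuclideanSpace ℝ (Fin 3) // μ {q} ≠ 0 ∧ q ≠ p} => ((dist p (q : EuclideanSpace ℝ (Fin 3)))⁻¹ ^ 8 - (dist p (q : EuclideanSpace ℝ (Fin 3)))⁻¹ ^ 14) • (p - (q : EuclideanSpace ℝ (Fin 3)))) 0 ∧ (∃ L : ℝ, 0 ≤ L ∧ HasSum (fun q : {q : EuclideanSpace ℝ (Fin 3) // μ {q} ≠ 0 ∧ q ≠ p} => 11 * (dist p (q : EuclideanSpace ℝ (Fin 3)))⁻¹ ^ 14 - 5 * (dist p (q : EuclideanSpace ℝ (Fin 3)))⁻¹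 ^ 8) L) ∧ ((∃ q : EuclideanSpace ℝ (Fin 3), μ {q} ≠ 0 ∧ q ≠ p) → ∃ q : EuclideanSpace ℝ (Fin 3), μ {q} ≠ 0 ∧ q ≠ p ∧ dist p q ^ 6 ≤ 11 / 5)) → {p : EuclideanSpace ℝ (Fin 3) | μ {p} ≠ 0}.Infinite → ¬ (∃ Q : Literature.MathematicalPhysics.StatisticalMechanics.PeriodicConfiguration 3, ∃ t : EuclideanSpace ℝ (Fin 3), {p : EuclideanSpace ℝ (Fin 3) | μ {p} ≠ 0} = (fun s => s + t) '' Q.points) → 0 < (∫ y in Metric.closedBall (0 : EuclideanSpace ℝ (Fin 3)) r, ((∫ z in Metric.closedBall (0 : EuclideanSpace ℝ (Fin 3)) Rc, Literature.MathematicalPhysics.StatisticalMechanics.lennardJones ‖z‖ ∂(MeasureTheory.Measure.map (fun z : EuclideanSpace ℝ (Fin 3) => z - y) μ)) / 2 - ((7 / 10 : ℝ)⁻¹ ^ 6 / 12 + 1 / 6) * (250 * (7 / 10 : ℝ)⁻¹ ^ 3 * Rc⁻¹ ^ 3) / 2 - (⨅ Q : Literature.MathematicalPhysics.StatisticalMechanics.PeriodicConfiguration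 3, Q.energyPerParticle Literature.MathematicalPhysics.StatisticalMechanics.lennardJones)) / ((MeasureTheory.Measure.map (fun z : EuclideanSpace ℝ (Fin 3) => z - y) μ) (Metric.closedBall (0 : EuclideanSpace ℝ (Fin 3)) r)).toReal ∂μ)) := by
  classical
  intro δ hδ R₇ R₈ R₉
  have h' := h δ hδ R₇ R₈ R₉
  dsimp only at h' ⊢
  obtain ⟨r, hr, Rc, hRc, hF⟩ := h'
  refine ⟨r, hr, Rc, hRc, fun μ hμδ hμ7 hd he hE hinf hnp => ?_⟩
  obtain ⟨S, h0S, hsep, hμS⟩ := id hμ7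
  have h7 : (0 : ℝ) < 7 / 10 := by norm_num
  -- δ-separation of the same carrier
  have hsepδ : ∀ a ∈ S, ∀ b ∈ S, a ≠ b → δ ≤ dist a b := by
    obtain ⟨S', -, hsep', hμS'⟩ := hμδ
    intro a ha b hb hab
    have ha' : a ∈ S' := (count_restrict_singleton_ne_zero_iff S' a).mp (by rw [← hμS', hμS]; exact (count_restrict_singleton_ne_zero_iff S a).mpr ha)
    have hb' : b ∈ S' := (count_restrict_singleton_ne_zero_iff S' b).mp (by rw [← hμS', hμS]; exact (count_restrict_singleton_ne_zero_iff S b).mpr hb)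
    exact hsep' a ha' b hb' hab
  -- the finite cluster: the configuration's content of the ball of radius ρ = 2r + Rc + 1
  set ρ : ℝ := 2 * r + Rc + 1 with hρ
  have hrρ : r ≤ ρ := by rw [hρ]; linarith
  have hρ0 : 0 ≤ ρ := by rw [hρ]; linarith
  have hfinρ : (closedBall (0 : E3) ρ ∩ S).Finite := finite_inter_of_separated h7 hsep (isCompact_closedBall (0 : E3) ρ)
  set ω : Finset E3 := hfinρ.toFinset with hω
  have hmemω : ∀ p : E3, p ∈ ω ↔ ‖p‖ ≤ ρ ∧ p ∈ S := fun p => by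
    rw [hω, Finite.mem_toFinset, mem_inter_iff, mem_closedBall, dist_zero_right]
  -- admissibility of the cluster
  have h0ω : (0 : E3) ∈ ω := (hmemω 0).mpr ⟨by rw [norm_zero]; exact hρ0, h0S⟩
  have hballω : ∀ p ∈ ω, ‖p‖ ≤ 2 * r + Rc + 1 := fun p hp => by have := ((hmemω p).mp hp).1; rw [hρ] at this; exact this
  have hsepω : ∀ a ∈ ω, ∀ b ∈ ω, a ≠ b → δ ≤ dist a b := fun a ha b hb hab =>
    hsepδ a ((hmemω a).mp ha).2 b ((hmemω b).mp hb).2 hab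
  have hsep7ω : ∀ a ∈ ω, ∀ b ∈ ω, a ≠ b → (7 : ℝ) / 10 ≤ dist a b := fun a ha b hb hab =>
    hsep a ((hmemω a).mp ha).2 b ((hmemω b).mp hb).2 hab
  have hpos := hF ω h0ω hballω hsepω hsep7ω (fun q hq hqr ε hε hε1 => by
    have hqS : q ∈ S := ((hmemω q).mp hq).2
    have hq0 : μ {q} ≠ 0 := by rw [hμS]; exact (count_restrict_singleton_ne_zero_iff S q).mpr hqS
    obtain ⟨N, y, i, hT, hm1, hm2⟩ := hd q hq0 (r + Rc) ε hε
    refine ⟨N, y, i, hT, fun p hp hpq => ?_, fun k hk => ?_⟩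
    · have hpS : p ∈ S := ((hmemω p).mp hp).2
      exact hm1 p (by rw [hμS]; exact (count_restrict_singleton_ne_zero_iff S p).mpr hpS) hpq
    · obtain ⟨p, hp0, hpk⟩ := hm2 k hk
      have hpS : p ∈ S := by rw [hμS] at hp0; exact (count_restrict_singleton_ne_zero_iff S p).mp hp0
      refine ⟨p, (hmemω p).mpr ⟨?_, hpS⟩, hpk⟩
      have h1 : ‖p - q‖ ≤ ‖y k - y i‖ + ε := by
        have hdk : ‖p - q - (y k - y i)‖ ≤ ε := by
          rw [← dist_eq_norm, dist_comm]; exact hpk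
        calc ‖p - q‖ = ‖(p - q - (y k - y i)) + (y k - y i)‖ := by rw [sub_add_cancel]
          _ ≤ ‖p - q - (y k - y i)‖ + ‖y k - y i‖ := norm_add_le _ _
          _ ≤ ‖y k - y i‖ + ε := by linarith
      have h2 : ‖y k - y i‖ ≤ r + Rc := by rw [← dist_eq_norm]; exact hk
      calc ‖p‖ = ‖(p - q) + q‖ := by rw [sub_add_cancel]
        _ ≤ ‖p - q‖ + ‖q‖ := norm_add_le _ _
        _ ≤ ρ := by rw [hρ]; linarith)
  -- the truncated integral IS the finite sum
  have hfinr : (closedBall (0 : E3) r ∩ S).Finite := finite_inter_of_separated h7 hsep (isCompact_closedBall (0 : E3) r)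
  have hωr : hfinr.toFinset = ω.filter (fun y : E3 => ‖y‖ ≤ r) := by
    ext y
    rw [Finite.mem_toFinset, Finset.mem_filter, hmemω, mem_inter_iff, mem_closedBall, dist_zero_right]
    constructor
    · rintro ⟨hy, hyS⟩; exact ⟨⟨hy.trans hrρ, hyS⟩, hy⟩
    · rintro ⟨⟨-, hyS⟩, hy⟩; exact ⟨hy, hyS⟩
  have hball_sub : ∀ y : E3, ‖y‖ ≤ r → ∀ R : ℝ, R ≤ r + Rc → ∀ q : E3, ‖q - y‖ ≤ R → ‖q‖ ≤ ρ := by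
    intro y hy R hR q hq
    calc ‖q‖ = ‖(q - y) + y‖ := by rw [sub_add_cancel]
      _ ≤ ‖q - y‖ + ‖y‖ := norm_add_le _ _
      _ ≤ ρ := by rw [hρ]; linarith
  have hfilt : ∀ y : E3, ‖y‖ ≤ r → ∀ R : ℝ, R ≤ r + Rc → ∀ hfin : (closedBall y R ∩ S).Finite,
      hfin.toFinset = ω.filter (fun q : E3 => ‖q - y‖ ≤ R) := by
    intro y hy R hR hfin
    ext q
    rw [Finite.mem_toFinset, Finset.mem_filter, hmemω, mem_inter_iff, mem_closedBall, dist_eq_norm]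
    constructor
    · rintro ⟨hq, hqS⟩; exact ⟨⟨hball_sub y hy R hR q hq, hqS⟩, hq⟩
    · rintro ⟨⟨-, hqS⟩, hq⟩; exact ⟨hq, hqS⟩
  have heq : (∫ y in closedBall (0 : E3) r, ((∫ z in closedBall (0 : E3) Rc, lennardJones ‖z‖ ∂(μ.map fun z : E3 => z - y)) / 2 -
        ((7 / 10 : ℝ)⁻¹ ^ 6 / 12 + 1 / 6) * (250 * (7 / 10 : ℝ)⁻¹ ^ 3 * Rc⁻¹ ^ 3) / 2 -
        (⨅ Q : PeriodicConfiguration 3, Q.energyPerParticle lennardJones)) /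
        ((μ.map fun z : E3 => z - y) (closedBall (0 : E3) r)).toReal ∂μ) =
      ∑ y ∈ ω.filter (fun y : E3 => ‖y‖ ≤ r),
        ((∑ q ∈ ω.filter (fun q : E3 => ‖q - y‖ ≤ Rc), lennardJones ‖q - y‖) / 2 -
          ((7 / 10 : ℝ)⁻¹ ^ 6 / 12 + 1 / 6) * (250 * (7 / 10 : ℝ)⁻¹ ^ 3 * Rc⁻¹ ^ 3) / 2 -
          (⨅ Q : PeriodicConfiguration 3, Q.energyPerParticle lennardJones)) /
        ((ω.filter (fun q : E3 => ‖q - y‖ ≤ r)).card : ℝ) := by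
    rw [hμS, Measure.restrict_restrict measurableSet_closedBall]
    have hcoe : (Measure.count : Measure E3).restrict (closedBall (0 : E3) r ∩ S) =
        (Measure.count : Measure E3).restrict (↑hfinr.toFinset : Set E3) := by rw [Finite.coe_toFinset]
    rw [hcoe, integral_count_restrict_coe_finset, hωr]
    refine Finset.sum_congr rfl fun y hy => ?_
    have hyr : ‖y‖ ≤ r := (Finset.mem_filter.mp hy).2
    have hfinRc : (closedBall y Rc ∩ S).Finite := finite_inter_of_separated h7 hsep (isCompact_closedBall y Rc)
    have hfinyr : (closedBall y r ∩ S).Finite := finite_inter_of_separated h7 hsep (isCompact_closedBall y r)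
    rw [setIntegral_map_sub_eq_sum y Rc hfinRc, hfilt y hyr Rc (by linarith) hfinRc, map_sub_apply_closedBall,
      count_restrict_closedBall_eq_card y r hfinyr, hfilt y hyr r (by linarith) hfinyr, ENNReal.toReal_natCast]
  rw [heq]
  exact hpos

/-- **FINITE-CLUSTER DOOR (crux, by name)** — THE INSTRUMENTABLE RESIDUAL: a finite inequality per admissible finite cluster of radius
`2r + Rc + 1` implies `AperiodicFrustratedLawGap`. [folklore] -/
theorem aperiodicFrustratedLawGap_of_finiteClusterPrice
    (h : ∀ δ : ℝ, 0 < δ → ∀ R₇ R₈ R₉ : ℝ, let Gy : ℝ → (N : ℕ) → (Fin N → EuclideanSpace ℝ (Fin 3)) → Fin N → Prop := fun η N y j => let d : ℝ := sInf ((fun z => dist z (y (j : Fin N))) '' (Set.range (y) \ {(y (j : Fin N))})); let T : Set (EuclideanSpace ℝ (Fin 3)) := {z : EuclideanSpace ℝ (Fin 3) | z ∈ Set.range (y) ∧ z ≠ (y (j : Fin N)) ∧ dist z (y (j : Fin N)) < 13 / 10 * d}; ∃ A : EuclideanSpace ℝ (Fin 3) →ₗᵢ[ℝ] EuclideanSpace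 ℝ (Fin 3), (∃ e : ↥T ≃ ↥Literature.Geometry.DiscreteGeometry.fccKissingPattern, ∀ t : ↥T, dist (d⁻¹ • ((t : EuclideanSpace ℝ (Fin 3)) - (y (j : Fin N)))) (A ((e t : ↥Literature.Geometry.DiscreteGeometry.fccKissingPattern) : EuclideanSpace ℝ (Fin 3))) ≤ η) ∨ (∃ e : ↥T ≃ ↥Literature.Geometry.DiscreteGeometry.hcpKissingPattern, ∀ t : ↥T, dist (d⁻¹ • ((t : EuclideanSpace ℝ (Fin 3)) - (y (j : Fin N)))) (A ((e t : ↥Literature.Geometry.DiscreteGeometry.hcpKissingPattern) : EuclideanSpace ℝ (Fin 3))) ≤ η); let TexBall : (N : ℕ) → (Fin N → EuclideanSpace ℝ (Fin 3)) → Fin N → ℝ → ℝ → ℝ → ℝ → Prop := fun N y i R R₇ R₈ R₉ => (∀ a b : Fin N, a ≠ b → (7 : ℝ) / 10 ≤ dist (y a) (y b)) ∧ (∀ j : Fin N, dist (y j) (y i) ≤ R → ¬ Gy (1 / 20) N (y) j) ∧ (∀ j : Fin N, dist (y j) (y i) ≤ R → ¬ ((∀ j' : Fin N, dist (y j') (y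 j) ≤ R₇ → ¬ Gy (1 / 20) N (y) j') ∧ (∀ z : EuclideanSpace ℝ (Fin 3), dist z (y j) ≤ R₇ → ∃ k : Fin N, dist z (y k) ≤ 1) ∧ (∀ j' : Fin N, dist (y j') (y j) ≤ R₇ → (let d : ℝ := sInf ((fun z => dist z (y j')) '' (Set.range (y) \ {(y j')})); ∀ k : Fin N, y k ≠ y j' → dist (y k) (y j') < 27 / 20 * d → 5 ≤ Nat.card {m : Fin N // y m ≠ y j' ∧ dist (y m) (y j') < 27 / 20 * d ∧ y m ≠ y k ∧ dist (y m) (y k) < 27 / 20 * d})))) ∧ (∀ j : Fin N, dist (y j) (y i) ≤ R → ∃ k : Fin N, dist (y k) (y j) ≤ R₈ ∧ Gy (1 / 8) N (y) k) ∧ (∀ j : Fin N, dist (y j) (y i) ≤ R → ¬ ((∀ j' : Fin N, dist (y j') (y j) ≤ R₉ → ¬ Gy (1 / 20) N (y) j') ∧ (Nat.card {j' : Fin N // dist (y j') (y j) ≤ R₉ ∧ ¬ Gy (1 / 8) N (y) j'} : ℝ) ≤ 1 / 2 * (Nat.card {j' : Fin N // dist (y j') (y j) ≤ R₉} : ℝ)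 ∧ (∀ j' : Fin N, dist (y j') (y j) ≤ R₉ → ¬ Gy (1 / 8) N (y) j' → ¬ (let d : ℝ := sInf ((fun z => dist z (y j')) '' (Set.range (y) \ {(y j')})); ∀ k : Fin N, y k ≠ y j' → dist (y k) (y j') < 27 / 20 * d → 5 ≤ Nat.card {m : Fin N // y m ≠ y j' ∧ dist (y m) (y j') < 27 / 20 * d ∧ y m ≠ y k ∧ dist (y m) (y k) < 27 / 20 * d})))); ∃ r : ℝ, 0 < r ∧ ∃ Rc : ℝ, 7 / 10 ≤ Rc ∧ ∀ ω : Finset (EuclideanSpace ℝ (Fin 3)), (0 : EuclideanSpace ℝ (Fin 3)) ∈ ω → (∀ p ∈ ω, ‖p‖ ≤ 2 * r + Rc + 1) → (∀ a ∈ ω, ∀ b ∈ ω, a ≠ b → δ ≤ dist a b) → (∀ a ∈ ω, ∀ b ∈ ω, a ≠ b → (7 : ℝ) / 10 ≤ dist a b) → (∀ q ∈ ω, ‖q‖ ≤ r → ∀ ε : ℝ, 0 < ε → ε ≤ 1 → ∃ (N : ℕ) (y : Fin N → EuclideanSpace ℝ (Fin 3)) (i : Fin N), TexBall N y i (r + Rc)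 R₇ R₈ R₉ ∧ (∀ p ∈ ω, dist p q ≤ r + Rc → ∃ k : Fin N, dist (y k - y i) (p - q) ≤ ε) ∧ (∀ k : Fin N, dist (y k) (y i) ≤ r + Rc → ∃ p ∈ ω, dist (y k - y i) (p - q) ≤ ε)) → 0 < (∑ y ∈ ω.filter (fun y : EuclideanSpace ℝ (Fin 3) => ‖y‖ ≤ r), ((∑ q ∈ ω.filter (fun q : EuclideanSpace ℝ (Fin 3) => ‖q - y‖ ≤ Rc), Literature.MathematicalPhysics.StatisticalMechanics.lennardJones ‖q - y‖) / 2 - ((7 / 10 : ℝ)⁻¹ ^ 6 / 12 + 1 / 6) * (250 * (7 / 10 : ℝ)⁻¹ ^ 3 * Rc⁻¹ ^ 3) / 2 - (⨅ Q : Literature.MathematicalPhysics.StatisticalMechanics.PeriodicConfiguration 3, Q.energyPerParticle Literature.MathematicalPhysics.StatisticalMechanics.lennardJones)) / ((ω.filter (fun q : EuclideanSpace ℝ (Fin 3) => ‖q - y‖ ≤ r)).card : ℝ))) :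
    Summit.AtomisticToContinuum.Crystallization.Theses.FrustratedLawDichotomy.AperiodicFrustratedLawGap :=
  aperiodicFrustratedLawGap_of_truncatedSurplusPrice (truncatedSurplusPrice_of_finiteClusterPrice h)

/-- **FINITE-CLUSTER DOOR for the registered stub** (`S_aperiodicErgodicGap` verbatim). [folklore] -/
theorem aperiodicErgodicGap_of_finiteClusterPrice
    (h : ∀ δ : ℝ, 0 < δ → ∀ R₇ R₈ R₉ : ℝ, let Gy : ℝ → (N : ℕ) → (Fin N → EuclideanSpace ℝ (Fin 3)) → Fin N → Prop := fun η N y j => let d : ℝ := sInf ((fun z => dist z (y (j : Fin N))) '' (Set.range (y) \ {(y (j : Fin N))})); let T : Set (EuclideanSpace ℝ (Fin 3)) := {z : EuclideanSpace ℝ (Fin 3) | z ∈ Set.range (y) ∧ z ≠ (y (j : Fin N)) ∧ dist z (y (j : Fin N)) < 13 / 10 * d}; ∃ A : EuclideanSpace ℝ (Fin 3) →ₗᵢ[ℝ] EuclideanSpace ℝ (Fin 3), (∃ e : ↥T ≃ ↥Literature.Geometry.DiscreteGeometry.fccKissingPattern, ∀ t : ↥T, dist (d⁻¹ • ((t : EuclideanSpace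 ℝ (Fin 3)) - (y (j : Fin N)))) (A ((e t : ↥Literature.Geometry.DiscreteGeometry.fccKissingPattern) : EuclideanSpace ℝ (Fin 3))) ≤ η) ∨ (∃ e : ↥T ≃ ↥Literature.Geometry.DiscreteGeometry.hcpKissingPattern, ∀ t : ↥T, dist (d⁻¹ • ((t : EuclideanSpace ℝ (Fin 3)) - (y (j : Fin N)))) (A ((e t : ↥Literature.Geometry.DiscreteGeometry.hcpKissingPattern) : EuclideanSpace ℝ (Fin 3))) ≤ η); let TexBall : (N : ℕ) → (Fin N → EuclideanSpace ℝ (Fin 3)) → Fin N → ℝ → ℝ → ℝ → ℝ → Prop := fun N y i R R₇ R₈ R₉ => (∀ a b : Fin N, a ≠ b → (7 : ℝ) / 10 ≤ dist (y a) (y b)) ∧ (∀ j : Fin N, dist (y j) (y i) ≤ R → ¬ Gy (1 / 20) N (y) j) ∧ (∀ j : Fin N, dist (y j) (y i) ≤ R → ¬ ((∀ j' : Fin N, dist (y j') (y j) ≤ R₇ → ¬ Gy (1 / 20) N (y) j') ∧ (∀ z : EuclideanSpace ℝ (Fin 3), dist z (y j) ≤ R₇ → ∃ k : Fin N, dist z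 (y k) ≤ 1) ∧ (∀ j' : Fin N, dist (y j') (y j) ≤ R₇ → (let d : ℝ := sInf ((fun z => dist z (y j')) '' (Set.range (y) \ {(y j')})); ∀ k : Fin N, y k ≠ y j' → dist (y k) (y j') < 27 / 20 * d → 5 ≤ Nat.card {m : Fin N // y m ≠ y j' ∧ dist (y m) (y j') < 27 / 20 * d ∧ y m ≠ y k ∧ dist (y m) (y k) < 27 / 20 * d})))) ∧ (∀ j : Fin N, dist (y j) (y i) ≤ R → ∃ k : Fin N, dist (y k) (y j) ≤ R₈ ∧ Gy (1 / 8) N (y) k) ∧ (∀ j : Fin N, dist (y j) (y i) ≤ R → ¬ ((∀ j' : Fin N, dist (y j') (y j) ≤ R₉ → ¬ Gy (1 / 20) N (y) j') ∧ (Nat.card {j' : Fin N // dist (y j') (y j) ≤ R₉ ∧ ¬ Gy (1 / 8) N (y) j'} : ℝ) ≤ 1 / 2 * (Nat.card {j' : Fin N // dist (y j') (y j) ≤ R₉} : ℝ) ∧ (∀ j' : Fin N, dist (y j') (y j) ≤ R₉ → ¬ Gy (1 / 8) N (y) j' → ¬ (let d : ℝ := sInf ((fun z => dist z (y j')) ''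 (Set.range (y) \ {(y j')})); ∀ k : Fin N, y k ≠ y j' → dist (y k) (y j') < 27 / 20 * d → 5 ≤ Nat.card {m : Fin N // y m ≠ y j' ∧ dist (y m) (y j') < 27 / 20 * d ∧ y m ≠ y k ∧ dist (y m) (y k) < 27 / 20 * d})))); ∃ r : ℝ, 0 < r ∧ ∃ Rc : ℝ, 7 / 10 ≤ Rc ∧ ∀ ω : Finset (EuclideanSpace ℝ (Fin 3)), (0 : EuclideanSpace ℝ (Fin 3)) ∈ ω → (∀ p ∈ ω, ‖p‖ ≤ 2 * r + Rc + 1) → (∀ a ∈ ω, ∀ b ∈ ω, a ≠ b → δ ≤ dist a b) → (∀ a ∈ ω, ∀ b ∈ ω, a ≠ b → (7 : ℝ) / 10 ≤ dist a b) → (∀ q ∈ ω, ‖q‖ ≤ r → ∀ ε : ℝ, 0 < ε → ε ≤ 1 → ∃ (N : ℕ) (y : Fin N → EuclideanSpace ℝ (Fin 3)) (i : Fin N), TexBall N y i (r + Rc) R₇ R₈ R₉ ∧ (∀ p ∈ ω, dist p q ≤ r + Rc → ∃ k : Fin N, dist (y k - y i) (p - q) ≤ ε) ∧ (∀ k : Fin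 N, dist (y k) (y i) ≤ r + Rc → ∃ p ∈ ω, dist (y k - y i) (p - q) ≤ ε)) → 0 < (∑ y ∈ ω.filter (fun y : EuclideanSpace ℝ (Fin 3) => ‖y‖ ≤ r), ((∑ q ∈ ω.filter (fun q : EuclideanSpace ℝ (Fin 3) => ‖q - y‖ ≤ Rc), Literature.MathematicalPhysics.StatisticalMechanics.lennardJones ‖q - y‖) / 2 - ((7 / 10 : ℝ)⁻¹ ^ 6 / 12 + 1 / 6) * (250 * (7 / 10 : ℝ)⁻¹ ^ 3 * Rc⁻¹ ^ 3) / 2 - (⨅ Q : Literature.MathematicalPhysics.StatisticalMechanics.PeriodicConfiguration 3, Q.energyPerParticle Literature.MathematicalPhysics.StatisticalMechanics.lennardJones)) / ((ω.filter (fun q : EuclideanSpace ℝ (Fin 3) => ‖q - y‖ ≤ r)).card : ℝ))) :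
    ∀ δ : ℝ, 0 < δ → ∀ P : MeasureTheory.Measure (MeasureTheory.Measure (EuclideanSpace ℝ (Fin 3))), let Gy : ℝ → (N : ℕ) → (Fin N → EuclideanSpace ℝ (Fin 3)) → Fin N → Prop := fun η N y j => let d : ℝ := sInf ((fun z => dist z (y (j : Fin N))) '' (Set.range (y) \ {(y (j : Fin N))})); let T : Set (EuclideanSpace ℝ (Fin 3)) := {z : EuclideanSpace ℝ (Fin 3) | z ∈ Set.range (y) ∧ z ≠ (y (j : Fin N)) ∧ dist z (y (j : Fin N)) < 13 / 10 * d}; ∃ A : EuclideanSpace ℝ (Fin 3) →ₗᵢ[ℝ] EuclideanSpace ℝ (Fin 3), (∃ e : ↥T ≃ ↥Literature.Geometry.DiscreteGeometry.fccKissingPattern, ∀ t : ↥T, dist (d⁻¹ • ((t : EuclideanSpace ℝ (Fin 3)) - (y (j : Fin N)))) (A ((e t : ↥Literature.Geometry.DiscreteGeometry.fccKissingPattern) : EuclideanSpace ℝ (Fin 3))) ≤ η) ∨ (∃ e : ↥T ≃ ↥Literature.Geometry.DiscreteGeometry.hcpKissingPattern, ∀ t : ↥T, dist (d⁻¹ •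 ((t : EuclideanSpace ℝ (Fin 3)) - (y (j : Fin N)))) (A ((e t : ↥Literature.Geometry.DiscreteGeometry.hcpKissingPattern) : EuclideanSpace ℝ (Fin 3))) ≤ η); let TexBall : (N : ℕ) → (Fin N → EuclideanSpace ℝ (Fin 3)) → Fin N → ℝ → ℝ → ℝ → ℝ → Prop := fun N y i R R₇ R₈ R₉ => (∀ a b : Fin N, a ≠ b → (7 : ℝ) / 10 ≤ dist (y a) (y b)) ∧ (∀ j : Fin N, dist (y j) (y i) ≤ R → ¬ Gy (1 / 20) N (y) j) ∧ (∀ j : Fin N, dist (y j) (y i) ≤ R → ¬ ((∀ j' : Fin N, dist (y j') (y j) ≤ R₇ → ¬ Gy (1 / 20) N (y) j') ∧ (∀ z : EuclideanSpace ℝ (Fin 3), dist z (y j) ≤ R₇ → ∃ k : Fin N, dist z (y k) ≤ 1) ∧ (∀ j' : Fin N, dist (y j') (y j) ≤ R₇ → (let d : ℝ := sInf ((fun z => dist z (y j')) '' (Set.range (y) \ {(y j')})); ∀ k : Fin N, y k ≠ y j' → dist (y k) (y j') < 27 / 20 * d → 5 ≤ Nat.card {m : Fin N // y m ≠ y j'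 ∧ dist (y m) (y j') < 27 / 20 * d ∧ y m ≠ y k ∧ dist (y m) (y k) < 27 / 20 * d})))) ∧ (∀ j : Fin N, dist (y j) (y i) ≤ R → ∃ k : Fin N, dist (y k) (y j) ≤ R₈ ∧ Gy (1 / 8) N (y) k) ∧ (∀ j : Fin N, dist (y j) (y i) ≤ R → ¬ ((∀ j' : Fin N, dist (y j') (y j) ≤ R₉ → ¬ Gy (1 / 20) N (y) j') ∧ (Nat.card {j' : Fin N // dist (y j') (y j) ≤ R₉ ∧ ¬ Gy (1 / 8) N (y) j'} : ℝ) ≤ 1 / 2 * (Nat.card {j' : Fin N // dist (y j') (y j) ≤ R₉} : ℝ) ∧ (∀ j' : Fin N, dist (y j') (y j) ≤ R₉ → ¬ Gy (1 / 8) N (y) j' → ¬ (let d : ℝ := sInf ((fun z => dist z (y j')) '' (Set.range (y) \ {(y j')})); ∀ k : Fin N, y k ≠ y j' → dist (y k) (y j') < 27 / 20 * d → 5 ≤ Nat.card {m : Fin N // y m ≠ y j' ∧ dist (y m) (y j') < 27 / 20 * d ∧ y m ≠ y k ∧ dist (y m) (y k) < 27 / 20 * d})))); let Appr : MeasureTheory.Measure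 (EuclideanSpace ℝ (Fin 3)) → ℝ → ℝ → ℝ → Prop := fun μ R₇ R₈ R₉ => ∀ q : EuclideanSpace ℝ (Fin 3), μ {q} ≠ 0 → ∀ R ε : ℝ, 0 < ε → ∃ (N : ℕ) (y : Fin N → EuclideanSpace ℝ (Fin 3)) (i : Fin N), TexBall N y i R R₇ R₈ R₉ ∧ (∀ p : EuclideanSpace ℝ (Fin 3), μ {p} ≠ 0 → dist p q ≤ R → ∃ k : Fin N, dist (y k - y i) (p - q) ≤ ε) ∧ (∀ k : Fin N, dist (y k) (y i) ≤ R → ∃ p : EuclideanSpace ℝ (Fin 3), μ {p} ≠ 0 ∧ dist (y k - y i) (p - q) ≤ ε); MeasureTheory.IsProbabilityMeasure P → (∀ᵐ μ ∂P, Literature.Probability.Process.IsRootedHardCore δ μ) → Literature.Probability.Process.IsPointStationaryLaw P → (∃ R₇ R₈ R₉ : ℝ, ∀ᵐ μ ∂P, Appr μ R₇ R₈ R₉) → (∀ᵐ μ ∂P, ∀ p : EuclideanSpace ℝ (Fin 3), μ {p} ≠ 0 → ∀ y : EuclideanSpace ℝ (Fin 3), (∀ q : EuclideanSpace ℝ (Fin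 3), μ {q} ≠ 0 → q ≠ p → y ≠ q) → ∑' q : {q : EuclideanSpace ℝ (Fin 3) // μ {q} ≠ 0 ∧ q ≠ p}, Literature.MathematicalPhysics.StatisticalMechanics.lennardJones (dist p (q : EuclideanSpace ℝ (Fin 3))) ≤ ∑' q : {q : EuclideanSpace ℝ (Fin 3) // μ {q} ≠ 0 ∧ q ≠ p}, Literature.MathematicalPhysics.StatisticalMechanics.lennardJones (dist y (q : EuclideanSpace ℝ (Fin 3)))) → P {μ : MeasureTheory.Measure (EuclideanSpace ℝ (Fin 3)) | ∃ Q : Literature.MathematicalPhysics.StatisticalMechanics.PeriodicConfiguration 3, ∃ t : EuclideanSpace ℝ (Fin 3), {p : EuclideanSpace ℝ (Fin 3) | μ {p} ≠ 0} = (fun s => s + t) '' Q.points} = 0 → (∀ A : Set (MeasureTheory.Measure (EuclideanSpace ℝ (Fin 3))), MeasurableSet A → (∀ μ : MeasureTheory.Measure (EuclideanSpace ℝ (Fin 3)), ∀ p : EuclideanSpace ℝ (Fin 3), μ {p} ≠ 0 → (μ ∈ A ↔ MeasureTheory.Measure.map (fun z : EuclideanSpace ℝ (Fin 3) => z - p)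 μ ∈ A)) → P A = 0 ∨ P Aᶜ = 0) → (⨅ Q : Literature.MathematicalPhysics.StatisticalMechanics.PeriodicConfiguration 3, Q.energyPerParticle Literature.MathematicalPhysics.StatisticalMechanics.lennardJones) < (∫ μ, Literature.MathematicalPhysics.StatisticalMechanics.rootEnergy Literature.MathematicalPhysics.StatisticalMechanics.lennardJones μ ∂P) :=
  aperiodicErgodicGap_of_truncatedSurplusPrice (truncatedSurplusPrice_of_finiteClusterPrice h)

/-- **FINITE-CLUSTER DOOR for the `PeriodicChargeSplit` copy.** [folklore] -/
theorem periodicChargeSplit_aperiodicFrustratedLawGap_of_finiteClusterPrice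
    (h : ∀ δ : ℝ, 0 < δ → ∀ R₇ R₈ R₉ : ℝ, let Gy : ℝ → (N : ℕ) → (Fin N → EuclideanSpace ℝ (Fin 3)) → Fin N → Prop := fun η N y j => let d : ℝ := sInf ((fun z => dist z (y (j : Fin N))) '' (Set.range (y) \ {(y (j : Fin N))})); let T : Set (EuclideanSpace ℝ (Fin 3)) := {z : EuclideanSpace ℝ (Fin 3) | z ∈ Set.range (y) ∧ z ≠ (y (j : Fin N)) ∧ dist z (y (j : Fin N)) < 13 / 10 * d}; ∃ A : EuclideanSpace ℝ (Fin 3) →ₗᵢ[ℝ] EuclideanSpace ℝ (Fin 3), (∃ e : ↥T ≃ ↥Literature.Geometry.DiscreteGeometry.fccKissingPattern, ∀ t : ↥T, dist (d⁻¹ • ((t : EuclideanSpace ℝ (Fin 3)) - (y (j : Fin N)))) (A ((e t : ↥Literature.Geometry.DiscreteGeometry.fccKissingPattern) : EuclideanSpace ℝ (Fin 3))) ≤ η) ∨ (∃ e : ↥T ≃ ↥Literature.Geometry.DiscreteGeometry.hcpKissingPattern, ∀ t : ↥T, dist (d⁻¹ • ((t : EuclideanSpace ℝ (Fin 3)) -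 (y (j : Fin N)))) (A ((e t : ↥Literature.Geometry.DiscreteGeometry.hcpKissingPattern) : EuclideanSpace ℝ (Fin 3))) ≤ η); let TexBall : (N : ℕ) → (Fin N → EuclideanSpace ℝ (Fin 3)) → Fin N → ℝ → ℝ → ℝ → ℝ → Prop := fun N y i R R₇ R₈ R₉ => (∀ a b : Fin N, a ≠ b → (7 : ℝ) / 10 ≤ dist (y a) (y b)) ∧ (∀ j : Fin N, dist (y j) (y i) ≤ R → ¬ Gy (1 / 20) N (y) j) ∧ (∀ j : Fin N, dist (y j) (y i) ≤ R → ¬ ((∀ j' : Fin N, dist (y j') (y j) ≤ R₇ → ¬ Gy (1 / 20) N (y) j') ∧ (∀ z : EuclideanSpace ℝ (Fin 3), dist z (y j) ≤ R₇ → ∃ k : Fin N, dist z (y k) ≤ 1) ∧ (∀ j' : Fin N, dist (y j') (y j) ≤ R₇ → (let d : ℝ := sInf ((fun z => dist z (y j')) '' (Set.range (y) \ {(y j')})); ∀ k : Fin N, y k ≠ y j' → dist (y k) (y j') < 27 / 20 * d → 5 ≤ Nat.card {m : Fin N // y m ≠ y j' ∧ dist (y m) (y j') < 27 / 20 * d ∧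 y m ≠ y k ∧ dist (y m) (y k) < 27 / 20 * d})))) ∧ (∀ j : Fin N, dist (y j) (y i) ≤ R → ∃ k : Fin N, dist (y k) (y j) ≤ R₈ ∧ Gy (1 / 8) N (y) k) ∧ (∀ j : Fin N, dist (y j) (y i) ≤ R → ¬ ((∀ j' : Fin N, dist (y j') (y j) ≤ R₉ → ¬ Gy (1 / 20) N (y) j') ∧ (Nat.card {j' : Fin N // dist (y j') (y j) ≤ R₉ ∧ ¬ Gy (1 / 8) N (y) j'} : ℝ) ≤ 1 / 2 * (Nat.card {j' : Fin N // dist (y j') (y j) ≤ R₉} : ℝ) ∧ (∀ j' : Fin N, dist (y j') (y j) ≤ R₉ → ¬ Gy (1 / 8) N (y) j' → ¬ (let d : ℝ := sInf ((fun z => dist z (y j')) '' (Set.range (y) \ {(y j')})); ∀ k : Fin N, y k ≠ y j' → dist (y k) (y j') < 27 / 20 * d → 5 ≤ Nat.card {m : Fin N // y m ≠ y j' ∧ dist (y m) (y j') < 27 / 20 * d ∧ y m ≠ y k ∧ dist (y m) (y k) < 27 / 20 * d})))); ∃ r : ℝ, 0 < r ∧ ∃ Rc : ℝ, 7 / 10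 ≤ Rc ∧ ∀ ω : Finset (EuclideanSpace ℝ (Fin 3)), (0 : EuclideanSpace ℝ (Fin 3)) ∈ ω → (∀ p ∈ ω, ‖p‖ ≤ 2 * r + Rc + 1) → (∀ a ∈ ω, ∀ b ∈ ω, a ≠ b → δ ≤ dist a b) → (∀ a ∈ ω, ∀ b ∈ ω, a ≠ b → (7 : ℝ) / 10 ≤ dist a b) → (∀ q ∈ ω, ‖q‖ ≤ r → ∀ ε : ℝ, 0 < ε → ε ≤ 1 → ∃ (N : ℕ) (y : Fin N → EuclideanSpace ℝ (Fin 3)) (i : Fin N), TexBall N y i (r + Rc) R₇ R₈ R₉ ∧ (∀ p ∈ ω, dist p q ≤ r + Rc → ∃ k : Fin N, dist (y k - y i) (p - q) ≤ ε) ∧ (∀ k : Fin N, dist (y k) (y i) ≤ r + Rc → ∃ p ∈ ω, dist (y k - y i) (p - q) ≤ ε)) → 0 < (∑ y ∈ ω.filter (fun y : EuclideanSpace ℝ (Fin 3) => ‖y‖ ≤ r), ((∑ q ∈ ω.filter (fun q : EuclideanSpace ℝ (Fin 3) => ‖q - y‖ ≤ Rc), Literature.MathematicalPhysics.StatisticalMechanics.lennardJones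 ‖q - y‖) / 2 - ((7 / 10 : ℝ)⁻¹ ^ 6 / 12 + 1 / 6) * (250 * (7 / 10 : ℝ)⁻¹ ^ 3 * Rc⁻¹ ^ 3) / 2 - (⨅ Q : Literature.MathematicalPhysics.StatisticalMechanics.PeriodicConfiguration 3, Q.energyPerParticle Literature.MathematicalPhysics.StatisticalMechanics.lennardJones)) / ((ω.filter (fun q : EuclideanSpace ℝ (Fin 3) => ‖q - y‖ ≤ r)).card : ℝ))) :
    Summit.AtomisticToContinuum.Crystallization.Theses.PeriodicChargeSplit.AperiodicFrustratedLawGap :=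
  periodicChargeSplit_aperiodicFrustratedLawGap_of_truncatedSurplusPrice (truncatedSurplusPrice_of_finiteClusterPrice h)

end Summit.AtomisticToContinuum.Crystallization.Theorems.FrustratedLawDichotomyTransportPriceFinite

end
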